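/-
Copyright (c) 2026 the pub-hodgecm-mathlib formalisation cell (harness21).  Prover seat hodgecm-mathlib-LH4-p04 (g7), req620 Track A «(D-RAM) FOUR-FRAME» squad
(STAGE-1b, heir LEAD F0P3a-plan (g20∕g21) T19-31∕T19-32 «row T₊ DERIVED»; dealer∕pen LH4-plan (g12) WORD #48 «(C2-lev-m_c)»; row-(2) lead LH4-p07 (g8) 10:09:55Z boundary), 2026-09-04.
-/
import Summits.HodgeConjecture.HodgeConjecture.Theorems.F0P3cDyRamBlockCensusOrderFormJointProfile   -- ★ p859229 (LH4-p07 (g8)): (C1-P^{a,b}) HEAD `ncard_fixed_selfDual_endoGL_lev_sq_eq_orderForm` (abstract block frame, two-multiplier cells)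
import Summits.HodgeConjecture.HodgeConjecture.Theorems.F0P3cDyRamBlockCensusOrderFormCM             -- ★ (LH4-p11 (g5)): the unit-piece twin (★ (C1) at the CM place); brings ★ Prelude `antidiagonal_three_over_eq_block_antidiagonal_two`, ★ FormTransport, ★ `conj_mem_unitaryGroupOfForm_iff`, ★ VertexStabilizerCoverCM
import Summits.HodgeConjecture.HodgeConjecture.Theorems.F0P3cDyRamProfilePiecesTypeTwoLatticeBridge    -- ★ p859323 (LH4-p07 (g8)): (L0-P) seam `ncard_typeZero_fixed_levels_eq_block` (token set = block-form set, on the nose); brings ★ DEFS `FourFrameCensusDefs` (`LatticeInLevel`, `dOfPlace`)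
import HarnessLib

/-!
# Crux `H413`, line LH4 «(D-RAM) FOUR-FRAME» — STAGE-1b, row (2): brick (C2-lev) «THE TYPE-(2) CENSUS OF THE UNLABELLED LEVEL PIECES `lev(a, b)` AT THE CM PLACE, IN THE TOKEN OF
# ★ p858704 `pieceCountDictionary_levels`»: `#{M ⊂ L_w³ ∣ type-0 vertex, ι_w(t)·M = M, (ι_w(t) − 1)·M ⊆ ϖ^a M, (ι_w(t) − 1)²·M ⊆ ϖ^b M}` = ★ p859229's order form at `(c, c′) := (ϖ^a, ϖ^b)`,
# for the two literal shapes `ι_w(t_h) = endoGL (γ₂, u)` (hyperbolic) and `ι_w(t_a) = P₁·endoGL (γ₁, u)·P₁⁻¹`, `ᵗσ(P₁) Φ₃ P₁ = block(diag dg, η)` (anisotropic); + the hermitian reading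

Cell `hodgecm-mathlib` (D-0151), FLOOR 0, crux item H413 = `stmt-HodgeConjecture-24833`, route of record `HCCMUnconditional`; squad F0∕P3c∕LH4; lane
`--supports stmt-HodgeConjecture-24833 --as helper` (count-neutral; pays NO tier-0 row; the STAGE-1b rows `stub_rows_transvPlus ∕ transvMinus ∕ regular` stay OPEN).
THEOREMS ONLY (no `def`, no instance, no notation, no `sorry`, default heartbeats).  Consumer: the chair's DERIVED road for row T₊ (T19-31 (b), T19-32; F0P3-p01 (g35) 10:05:32Z (γ)):
`rows(T₊) ⟸ rows(lev(ℓ₀, m_c)) ∧ rows(lev(ℓ₀+1, m_c)) ∧ rows(f_sgn′)` by ★ p858649 linearity, ROW (2) = the TYPE-(2) (toric) population.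

THE OBJECT.  ★ p858704 `pieceCountDictionary_levels (a b)` (LH4-p06 (g6)) prices the piece `𝟙_{K_{a,b}} = 𝟙{u ∈ K ∣ X ∈ ϖ^a M₃, X² ∈ ϖ^b M₃}` at ANY literal `T ∈ GL₃(L_w)` by the
census `cnt_{a,b}(T) := #{M ∣ IsVertexLattice σ_w ϖ (antidiag₃) 0 M ∧ T·M = M ∧ LatticeInLevel ϖ a (T − 1) M ∧ LatticeInLevel ϖ b ((T − 1)(T − 1)) M}` (the (J-lev-frame) socket ★
p858924 consumes exactly this token).  On ROW (2) the literals are the type-(2) ones of the (ρ2b′-X) road (★ p858565's socket (C″)): `ι_w(t_h) = endoGL (ι_w γ_H.1, ι_w γ_H.2)` and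
`ι_w(t_a) = P₁·endoGL (γ₁, ι_w γ_H.2)·P₁⁻¹`, `formCongr σ_w P₁ (Φ₃)_w = block(diag dg, η)`.  The GENERIC organ is ★ p859229 (LH4-p07 (g8)): in the abstract block frame
`(E, σ; H₂, h_W)` the census of `K_{c,c′}` at `Γ = endoGL (γ₂, u)` is an ORDER FORM over the line model `(M, jE, ρ, Θ, α; φ, lam, h)` with TWO-MULTIPLIER cone cells
`levelSetDep(j, b′; (jE c)⁻¹(lam − jE u₀₀)) ∩ levelSetDep(j, b′; (jE c′)⁻¹((lam − 1)² − jE (u₀₀ − 1)²))` (one-multiplier cells behind a lattice-free guard by this lineage's ★ p858944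
`…RamMTwoMult` ∕ ★ p859089 `…UnrTwoMult`, generically by LH4-p07's (G-unr)).  THIS FILE is the levels twin of ★ `F0P3cDyRamBlockCensusOrderFormCM` (the unit piece's CM-place
instance of ★ (C1)): ★ p859229 AT THE CM PLACE, in the two literal shapes, LHS spelled TOKEN FOR TOKEN as ★ p858704's `cnt_{a,b}` (`(c, c′) := (ϖ^a, ϖ^b)`; `jE (ϖ^n)` read `(jE ϖ)^n`).
* §1 `ncard_typeZero_fixed_endoGL_levels_eq_orderForm` — hyperbolic shape (`Φ₃ = block(Φ₂, 1)` on the nose: ★ p859323 (L0-P) seam `ncard_typeZero_fixed_levels_eq_block` BY NAME).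
* §2 `ncard_typeZero_fixed_conj_endoGL_levels_eq_orderForm` — anisotropic shape (★ FormTransport `ncard_selfDual_fixed_sep_eq_of_formCongr` with the TWO LEVEL LABELS, §0).
* §3 THE HERMITIAN READING (F0P3-p01 (g35) 10:05:48Z): for ANY `T ∈ GL₃` with `T·M = M`, `LatticeInLevel ϖ b ((T⁻¹ − 1)(T − 1)) M ↔ LatticeInLevel ϖ b ((T − 1)(T − 1)) M`
  (`(T⁻¹ − 1)(T − 1) = −T⁻¹(T − 1)²`; for unitary `T = 1 + X` this is `X^*X = −(X + X^*)`), hence the census with the hermitian square clause IS `cnt_{a,b}(T)`.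
INSTANCES OF RECORD: `(a, b) := (ℓ₀, m_c)`, `(ℓ₀ + 1, m_c)`, `ℓ₀ = dOfPlace L v w % 2`, `m_c` a PARAMETER (`mcOfRecord d := 2⌊(m* + d)∕2⌋` is LH4-p05 (g8)'s letter, not ★): both heads
are stated for arbitrary `(a, b)`, the instances are `… (dOfPlace L v w % 2) mc` ∕ `… (dOfPlace L v w % 2 + 1) mc` by `exact`.
HONEST LABEL.  Count-neutral lattice bookkeeping over ★ organs; no census law is stated; `HC_CM` is proved only modulo the 7 printed citations (2 remaining named inputs: hLiu418 =
`stmt-HodgeConjecture-24832`, h413 = `stmt-HodgeConjecture-24833`) until rung 0 closes.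
## References
* [Kottwitz1986BaseChangeUnits] R. E. Kottwitz, *Base change for unit elements of Hecke algebras*, Compositio Math. 60 (1986): §1 pp. 240–241.
* [Rogawski1990] J. D. Rogawski, *Automorphic Representations of Unitary Groups in Three Variables*, Ann. of Math. Stud. 123 (1990): §4.3 p. 43; §4.9 Prop. 4.9.1 (a)(b) pp. 54–55, Lemma 4.9.3 p. 56.
* [Jacobowitz1962] R. Jacobowitz, *Hermitian forms over local fields*, Amer. J. Math. 84 (1962): §4.  [BruhatTits1972] F. Bruhat, J. Tits, *Groupes réductifs sur un corps local I*, Publ. Math. IHÉS 41 (1972): §10.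
-/

set_option autoImplicit false

noncomputable section
namespace Summit.HodgeConjecture.HodgeConjecture.Cruxes.H413.F0P3cDyRamLevelsCensusOrderFormCM

open MeasureTheory Measure NumberField IsDedekindDomain Topology Filter
open Literature.NumberTheory.Automorphic Literature.NumberTheory.Automorphic.UnitaryGroup Literature.NumberTheory.Automorphic.IntegralReduction
open Literature.NumberTheory.Rogawski1990 Literature.NumberTheory.GaloisRepresentations
open Literature.NumberTheory.Automorphic.UnitaryThreeFourFrame
open scoped Matrix MatrixGroups Classical Valued WithZero
open Literature.NumberTheory.Automorphic.UnitaryLatticeTree Literature.NumberTheory.Automorphic.HermitianLattice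
open Literature.NumberTheory.Automorphic.EllipticPlaneAsFieldLine
open Literature.NumberTheory.LocalFields.QuadraticOrder
open Summit.HodgeConjecture.HodgeConjecture.Cruxes.H413.F0P3cDyRamToricCensusDefs
open Summit.HodgeConjecture.HodgeConjecture.Cruxes.H413.F0P3cDyRamBlockCensusOrderForm
open Summit.HodgeConjecture.HodgeConjecture.Cruxes.H413.F0P3cDyRamBlockCensusOrderFormJointProfile
open Summit.HodgeConjecture.HodgeConjecture.Cruxes.H413.F0P3cDyRamFixedPointCensusTypeTwoPrelude
open Summit.HodgeConjecture.HodgeConjecture.Cruxes.H413.F0P3cDyRamFourFrameCensusDefs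
open Summit.HodgeConjecture.HodgeConjecture.Cruxes.H413.F0P3cDyRamProfilePiecesTypeTwoLatticeBridge

/-! ## §0 Level labels under `M ↦ P·M`, and the place form as a block form -/

section Transport

variable {K : Type*} [Field K] [Valued K ℤᵐ⁰]

/-- **THE TWO LEVEL LABELS TRANSPORT** under `M ↦ P·M`, `γ ↦ PγP⁻¹`: `LatticeInLevel ϖ a (PγP⁻¹ − 1) (P·M) ∧ LatticeInLevel ϖ b ((PγP⁻¹ − 1)(PγP⁻¹ − 1)) (P·M) ↔
LatticeInLevel ϖ a (γ − 1) M ∧ LatticeInLevel ϖ b ((γ − 1)(γ − 1)) M` (★ FormTransport `map_toLin'_conj_mapGL_le_scaleLattice_iff`). [cite: Kottwitz1986BaseChangeUnits, §1 pp. 240–241] -/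
theorem latticeInLevel_and_conj_mapGL_iff (ϖ : K) (a b : ℕ) (P γ : GL (Fin 3) K) (M : Submodule 𝒪[K] (Fin 3 → K)) :
    (LatticeInLevel ϖ a (((P * γ * P⁻¹ : GL (Fin 3) K) : Matrix (Fin 3) (Fin 3) K) - 1) (mapGL P M) ∧
        LatticeInLevel ϖ b ((((P * γ * P⁻¹ : GL (Fin 3) K) : Matrix (Fin 3) (Fin 3) K) - 1) * (((P * γ * P⁻¹ : GL (Fin 3) K) : Matrix (Fin 3) (Fin 3) K) - 1)) (mapGL P M)) ↔
      (LatticeInLevel ϖ a ((γ : Matrix (Fin 3) (Fin 3) K) - 1) M ∧ LatticeInLevel ϖ b (((γ : Matrix (Fin 3) (Fin 3) K) - 1) * ((γ : Matrix (Fin 3) (Fin 3) K) - 1)) M) := by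
  have hconj : ((P * γ * P⁻¹ : GL (Fin 3) K) : Matrix (Fin 3) (Fin 3) K) - 1 =
      (P : Matrix (Fin 3) (Fin 3) K) * ((γ : Matrix (Fin 3) (Fin 3) K) - 1) * ((P⁻¹ : GL (Fin 3) K) : Matrix (Fin 3) (Fin 3) K) := by
    rw [Matrix.mul_sub, Matrix.sub_mul, Matrix.mul_one, Units.val_mul, Units.val_mul, Units.mul_inv]
  have hconj2 : (((P * γ * P⁻¹ : GL (Fin 3) K) : Matrix (Fin 3) (Fin 3) K) - 1) * (((P * γ * P⁻¹ : GL (Fin 3) K) : Matrix (Fin 3) (Fin 3) K) - 1) =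
      (P : Matrix (Fin 3) (Fin 3) K) * (((γ : Matrix (Fin 3) (Fin 3) K) - 1) * ((γ : Matrix (Fin 3) (Fin 3) K) - 1)) * ((P⁻¹ : GL (Fin 3) K) : Matrix (Fin 3) (Fin 3) K) := by
    rw [hconj]
    simp only [Matrix.mul_assoc]
    rw [← Matrix.mul_assoc ((P⁻¹ : GL (Fin 3) K) : Matrix (Fin 3) (Fin 3) K) (P : Matrix (Fin 3) (Fin 3) K), ← Units.val_mul, inv_mul_cancel, Units.val_one, Matrix.one_mul]
  unfold LatticeInLevel
  rw [hconj2, hconj, map_toLin'_conj_mapGL_le_scaleLattice_iff, map_toLin'_conj_mapGL_le_scaleLattice_iff]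

end Transport

/-! ## §1 The hyperbolic literal: `ι_w(t_h) = endoGL (γ₂, u)` for `Φ₃ = block(Φ₂, 1)` -/

/-- **(C2-lev) AT THE CM PLACE, HYPERBOLIC SHAPE — ★ p859229 in the token of ★ p858704 `pieceCountDictionary_levels (a b)`.**  For `Γ = endoGL (γ₂, u) ∈ U(σ_w, (Φ₃)_w)`, a line
model `(M, jE, ρ, Θ, α; φ, lam, h)` of the plane `((Φ₂)_w, γ₂)` and level schedules `a b : ℕ` with the near-`1` guards `|u₀₀ − 1| ≤ |ϖ|^a`, `|(u₀₀ − 1)²| ≤ |ϖ|^b`, under ★ p859229's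
own antecedents: `#{M₃ ∣ IsVertexLattice σ_w ϖ (antidiag₃) 0 M₃ ∧ Γ·M₃ = M₃ ∧ LatticeInLevel ϖ a (Γ − 1) M₃ ∧ LatticeInLevel ϖ b ((Γ − 1)(Γ − 1)) M₃}` — the (D-G) census `cnt_{a,b}(Γ)`
of the level piece `𝟙_{K_{a,b}}` — `=` ★ p859229's order form at `(H₂, h_W) := ((Φ₂)_w, 1)`, `(c, c′) := (ϖ^a, ϖ^b)` (axis indicator `[IsOrd_j lam ∧ IsOrd_j ((jE ϖ)^{−a}(lam − 1)) ∧
IsOrd_j ((jE ϖ)^{−b}(lam − 1)²)]·#levelSet(j, 0)`, two-multiplier cone cells `levelSetDep(j, b′; (jE ϖ)^{−a}(lam − jE u₀₀)) ∩ levelSetDep(j, b′; (jE ϖ)^{−b}((lam − 1)² − jE (u₀₀ − 1)²))`).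
[cite: Kottwitz1986BaseChangeUnits, §1 pp. 240–241] [cite: Rogawski1990, §4.3 p. 43; §4.9 Prop. 4.9.1 (a)(b) pp. 54–55] [cite: Jacobowitz1962, §4] [cite: BruhatTits1972, §10] -/
theorem ncard_typeZero_fixed_endoGL_levels_eq_orderForm (L : Type) [Field L] [NumberField L] [IsCMField L]
    {v : HeightOneSpectrum (𝓞 ↥(maximalRealSubfield L))} (w : UnitaryGroup.PlacesOver L v)
    (hw : IsCMField.complexConj L • w.1 = w.1) {ϖ : (w.1.adicCompletion L)} (hϖ : Valued.v ϖ = WithZero.exp (-1 : ℤ))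
    {M : Type*} [Field M] [Valued M ℤᵐ⁰] {ρ Θ : M →+* M} {α : M} (jE : (w.1.adicCompletion L) →+* M)
    (hρρ : ∀ x, ρ (ρ x) = x) (hvρ : ∀ x, Valued.v (ρ x) = Valued.v x) (hα : ρ α ≠ α) (hα1 : Valued.v α ≤ 1)
    (hint : ∀ z : M, Valued.v z ≤ 1 → Valued.v ((z - ρ z) / (α - ρ α)) ≤ 1)
    (hΘΘ : ∀ x, Θ (Θ x) = x) (hΘρ : ∀ x, Θ (ρ x) = ρ (Θ x)) (hvΘ : ∀ x, Valued.v (Θ x) = Valued.v x)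
    (hΘj : ∀ x, Θ (jE x) = jE ((galAdicCompletionMap (L := L) (IsCMField.complexConj L) hw) x))
    (hjv : ∀ c, Valued.v (jE c) ≤ 1 ↔ Valued.v c ≤ 1) (hjfix : ∀ z, ρ z = z ↔ ∃ c, jE c = z)
    (hjpow : ∀ (t : (w.1.adicCompletion L)) (n : ℤ), Valued.v (jE t) = Valued.v (jE ϖ) ^ n ↔ Valued.v t = Valued.v ϖ ^ n)
    (hEval : ∀ c : M, ρ c = c → c ≠ 0 → Valued.v c ≤ 1 → ∃ n : ℕ, Valued.v c = Valued.v (jE ϖ) ^ n)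
    (hϖmax : ∀ t : M, ρ t = t → Valued.v t < 1 → Valued.v t ≤ Valued.v (jE ϖ))
    (φ : (Fin 2 → (w.1.adicCompletion L)) →+ M) (hφs : ∀ (c : (w.1.adicCompletion L)) (x : Fin 2 → (w.1.adicCompletion L)), φ (c • x) = jE c * φ x)
    (hφi : Function.Injective φ) (hφo : Function.Surjective φ)
    (γ₂ : GL (Fin 2) (w.1.adicCompletion L)) {lam h : M} (hφγ : ∀ x, φ ((γ₂ : Matrix (Fin 2) (Fin 2) (w.1.adicCompletion L)).mulVec x) = lam * φ x) (hlam : Valued.v lam = 1)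
    (hΘh : Θ h = h) (hh : h ≠ 0)
    (hform : ∀ x y, jE (pairing (galAdicCompletionMap (L := L) (IsCMField.complexConj L) hw) (placeForm (Matrix.of fun i j : Fin 2 => if i.val + j.val + 1 = 2 then (1 : L) else 0) w.1) x y) =
      h * Θ (φ x) * φ y + ρ (h * Θ (φ x) * φ y))
    (u : GL (Fin 1) (w.1.adicCompletion L))
    (hΓ : endoGL (γ₂, u) ∈ unitaryGroupOfForm (galAdicCompletionMap (L := L) (IsCMField.complexConj L) hw) (placeForm (Matrix.of fun i j : Fin 3 => if i.val + j.val + 1 = 3 then (1 : L) else 0) w.1))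
    (hu : Valued.v ((u : Matrix (Fin 1) (Fin 1) (w.1.adicCompletion L)) 0 0) = 1) (a b : ℕ)
    (huc : Valued.v ((u : Matrix (Fin 1) (Fin 1) (w.1.adicCompletion L)) 0 0 - 1) ≤ Valued.v ϖ ^ a)
    (huc2 : Valued.v (((u : Matrix (Fin 1) (Fin 1) (w.1.adicCompletion L)) 0 0 - 1) ^ 2) ≤ Valued.v ϖ ^ b) {R : ℕ}
    (hfinF : {M₃ : Submodule (Valued.integer (w.1.adicCompletion L)) (Fin 3 → (w.1.adicCompletion L)) |
      IsVertexLattice (galAdicCompletionMap (L := L) (IsCMField.complexConj L) hw) ϖ ((StdForm.antidiagonal 3).over (w.1.adicCompletion L)) 0 M₃ ∧ mapGL (endoGL (γ₂, u)) M₃ = M₃}.Finite)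
    (hR : ∀ M₃ : Submodule (Valued.integer (w.1.adicCompletion L)) (Fin 3 → (w.1.adicCompletion L)),
      IsVertexLattice (galAdicCompletionMap (L := L) (IsCMField.complexConj L) hw) ϖ ((StdForm.antidiagonal 3).over (w.1.adicCompletion L)) 0 M₃ →
      mapGL (endoGL (γ₂, u)) M₃ = M₃ → ∀ b' : ℕ, (∀ c : (w.1.adicCompletion L), (Pi.single 1 c : Fin 3 → (w.1.adicCompletion L)) ∈ M₃ ↔ Valued.v c ≤ Valued.v ϖ ^ b') → b' ≤ R)
    {J : ℕ} (hJ : ¬ IsOrd ρ α (jE ϖ ^ (J + 1)) lam) (hfinLS : ∀ j a', (levelSet ρ Θ α (jE ϖ) h j a').Finite)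
    (f : ℕ → ℕ → AddSubgroup M → ℕ)
    (hf : ∀ (b' j : ℕ) (Λ : AddSubgroup M) (x₀ : M) (r : (w.1.adicCompletion L)), 1 ≤ b' → x₀ ≠ 0 →
      (∀ x, x ∈ Λ ↔ ∃ z, IsOrd ρ α (jE ϖ ^ j) z ∧ x = x₀ * z) →
      IsOrd ρ α (jE ϖ ^ j) (dualGen ρ Θ α (jE ϖ ^ j) h x₀) → ¬ IsOrd ρ α (jE ϖ ^ j) (dualGen ρ Θ α (jE ϖ ^ j) h x₀ / jE ϖ) →
      Valued.v (dualGen ρ Θ α (jE ϖ ^ j) h x₀) = Valued.v (jE ϖ) ^ b' →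
      (∀ b'', (∀ x ∈ Λ, Valued.v (h * Θ x * b'' + ρ (h * Θ x * b'')) ≤ 1) → (lam - jE ((u : Matrix (Fin 1) (Fin 1) (w.1.adicCompletion L)) 0 0)) * b'' ∈ Λ) →
      IsOrd ρ α (jE ϖ ^ j) lam → jE r = glueUnit ρ Θ α (jE ϖ ^ j) h (jE ϖ) (jE 1) x₀ b' →
      f b' j Λ = Nat.card {x : 𝒪[(w.1.adicCompletion L)] ⧸ 𝓂[(w.1.adicCompletion L)] ^ (2 * b') //
        ∃ u' : 𝒪[(w.1.adicCompletion L)], Ideal.Quotient.mk (𝓂[(w.1.adicCompletion L)] ^ (2 * b')) u' = x ∧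
          Valued.v ((u' : (w.1.adicCompletion L)) * (galAdicCompletionMap (L := L) (IsCMField.complexConj L) hw) u' - r) ≤ Valued.v (ϖ ^ (2 * b'))}) :
    {M₃ : Submodule (Valued.integer (w.1.adicCompletion L)) (Fin 3 → (w.1.adicCompletion L)) |
        IsVertexLattice (galAdicCompletionMap (L := L) (IsCMField.complexConj L) hw) ϖ ((StdForm.antidiagonal 3).over (w.1.adicCompletion L)) 0 M₃ ∧ mapGL (endoGL (γ₂, u)) M₃ = M₃ ∧
          (LatticeInLevel ϖ a (((endoGL (γ₂, u) : GL (Fin 3) (w.1.adicCompletion L)) : Matrix (Fin 3) (Fin 3) (w.1.adicCompletion L)) - 1) M₃ ∧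
            LatticeInLevel ϖ b ((((endoGL (γ₂, u) : GL (Fin 3) (w.1.adicCompletion L)) : Matrix (Fin 3) (Fin 3) (w.1.adicCompletion L)) - 1) *
              (((endoGL (γ₂, u) : GL (Fin 3) (w.1.adicCompletion L)) : Matrix (Fin 3) (Fin 3) (w.1.adicCompletion L)) - 1)) M₃)}.ncard =
      (∑ j ∈ Finset.range (J + 1), (if IsOrd ρ α (jE ϖ ^ j) lam ∧ IsOrd ρ α (jE ϖ ^ j) ((jE ϖ ^ a)⁻¹ * (lam - 1)) ∧
          IsOrd ρ α (jE ϖ ^ j) ((jE ϖ ^ b)⁻¹ * ((lam - 1) * (lam - 1))) then (levelSet ρ Θ α (jE ϖ) h j 0).ncard else 0)) +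
        ∑ b' ∈ Finset.Icc 1 R, ∑ j ∈ Finset.range (J + 1), (if IsOrd ρ α (jE ϖ ^ j) lam ∧ IsOrd ρ α (jE ϖ ^ j) ((jE ϖ ^ a)⁻¹ * (lam - 1)) ∧
            IsOrd ρ α (jE ϖ ^ j) ((jE ϖ ^ b)⁻¹ * ((lam - 1) * (lam - 1))) then
          ∑ᶠ Λ ∈ levelSetDep ρ Θ α (jE ϖ) h j b' ((jE ϖ ^ a)⁻¹ * (lam - jE ((u : Matrix (Fin 1) (Fin 1) (w.1.adicCompletion L)) 0 0))) ∩
            levelSetDep ρ Θ α (jE ϖ) h j b' ((jE ϖ ^ b)⁻¹ * ((lam - 1) * (lam - 1) - jE (((u : Matrix (Fin 1) (Fin 1) (w.1.adicCompletion L)) 0 0 - 1) ^ 2))), f b' j Λ else 0) := by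
  haveI : IsPrincipalIdealRing 𝒪[w.1.adicCompletion L] := isPrincipalIdealRing_integer_adicCompletion L v w
  have hσ : ∀ a', (galAdicCompletionMap (L := L) (IsCMField.complexConj L) hw) ((galAdicCompletionMap (L := L) (IsCMField.complexConj L) hw) a') = a' :=
    galAdicCompletionMap_involutive L v w hw
  have hvσ : ∀ a', Valued.v ((galAdicCompletionMap (L := L) (IsCMField.complexConj L) hw) a') = Valued.v a' :=
    fun a' => valued_galAdicCompletionMap (L := L) (IsCMField.complexConj L) hw a'
  have hH₂ : IsUnit (placeForm (Matrix.of fun i j : Fin 2 => if i.val + j.val + 1 = 2 then (1 : L) else 0) w.1).det :=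
    isUnit_det_placeForm L v w _ (isUnit_antidiagOne_det L 2).ne_zero
  have hH₂σ : ((placeForm (Matrix.of fun i j : Fin 2 => if i.val + j.val + 1 = 2 then (1 : L) else 0) w.1).map (galAdicCompletionMap (L := L) (IsCMField.complexConj L) hw))ᵀ =
      placeForm (Matrix.of fun i j : Fin 2 => if i.val + j.val + 1 = 2 then (1 : L) else 0) w.1 :=
    placeForm_map_transpose_of_hermitian L v w hw _ (antidiagOne_isHermitian L 2)
  -- the uniformiser: `ϖ^a, ϖ^b ≠ 0`, `|ϖ^a| ≤ 1`
  have hϖ0 : ϖ ≠ 0 := fun h0 => by rw [h0, map_zero] at hϖ; exact WithZero.coe_ne_zero hϖ.symm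
  have hϖ1 : Valued.v ϖ ≤ 1 := by rw [hϖ, ← WithZero.exp_zero]; exact WithZero.exp_le_exp.2 (by norm_num)
  have hc : ϖ ^ a ≠ 0 := pow_ne_zero _ hϖ0
  have hc' : ϖ ^ b ≠ 0 := pow_ne_zero _ hϖ0
  have hc1 : Valued.v (ϖ ^ a) ≤ 1 := by rw [map_pow]; exact pow_le_one' hϖ1 a
  have huc' : Valued.v ((u : Matrix (Fin 1) (Fin 1) (w.1.adicCompletion L)) 0 0 - 1) ≤ Valued.v (ϖ ^ a) := by rw [map_pow Valued.v ϖ a]; exact huc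
  have huc2' : Valued.v (((u : Matrix (Fin 1) (Fin 1) (w.1.adicCompletion L)) 0 0 - 1) ^ 2) ≤ Valued.v (ϖ ^ b) := by rw [map_pow Valued.v ϖ b]; exact huc2
  -- `Φ₃ = block(Φ₂, 1)` on the nose (★ Prelude)
  have hover : (StdForm.antidiagonal 3).over (w.1.adicCompletion L) =
      (!![(placeForm (Matrix.of fun i j : Fin 2 => if i.val + j.val + 1 = 2 then (1 : L) else 0) w.1) 0 0, 0,
          (placeForm (Matrix.of fun i j : Fin 2 => if i.val + j.val + 1 = 2 then (1 : L) else 0) w.1) 0 1;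
         0, (1 : w.1.adicCompletion L), 0;
         (placeForm (Matrix.of fun i j : Fin 2 => if i.val + j.val + 1 = 2 then (1 : L) else 0) w.1) 1 0, 0,
          (placeForm (Matrix.of fun i j : Fin 2 => if i.val + j.val + 1 = 2 then (1 : L) else 0) w.1) 1 1] : Matrix (Fin 3) (Fin 3) (w.1.adicCompletion L)) := by
    rw [placeForm_antidiagOne]
    exact antidiagonal_three_over_eq_block_antidiagonal_two _
  rw [setOf_typeZero_fixed_eq_setOf_isSelfDualLattice_block L w hw ϖ] at hfinF
  rw [placeForm_antidiagOne, hover] at hΓ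
  have hR' : ∀ M₃ : Submodule (Valued.integer (w.1.adicCompletion L)) (Fin 3 → (w.1.adicCompletion L)),
      IsSelfDualLattice (galAdicCompletionMap (L := L) (IsCMField.complexConj L) hw) ϖ
        (!![(placeForm (Matrix.of fun i j : Fin 2 => if i.val + j.val + 1 = 2 then (1 : L) else 0) w.1) 0 0, 0,
            (placeForm (Matrix.of fun i j : Fin 2 => if i.val + j.val + 1 = 2 then (1 : L) else 0) w.1) 0 1;
           0, (1 : w.1.adicCompletion L), 0;
           (placeForm (Matrix.of fun i j : Fin 2 => if i.val + j.val + 1 = 2 then (1 : L) else 0) w.1) 1 0, 0,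
            (placeForm (Matrix.of fun i j : Fin 2 => if i.val + j.val + 1 = 2 then (1 : L) else 0) w.1) 1 1] : Matrix (Fin 3) (Fin 3) (w.1.adicCompletion L)) M₃ →
      mapGL (endoGL (γ₂, u)) M₃ = M₃ → ∀ b' : ℕ, (∀ c : (w.1.adicCompletion L), (Pi.single 1 c : Fin 3 → (w.1.adicCompletion L)) ∈ M₃ ↔ Valued.v c ≤ Valued.v ϖ ^ b') → b' ≤ R := by
    intro M₃ hM₃ hfix b' hb'
    rw [← hover] at hM₃
    exact hR M₃ hM₃ hfix b' hb'
  have hf' := hf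
  simp only [map_one] at hf'
  have key := ncard_fixed_selfDual_endoGL_lev_sq_eq_orderForm (galAdicCompletionMap (L := L) (IsCMField.complexConj L) hw) hσ hvσ hϖ hH₂ hH₂σ
    (hW := (1 : w.1.adicCompletion L)) (by rw [map_one]) (map_one _) jE hρρ hvρ hα hα1 hint hΘΘ hΘρ hvΘ hΘj hjv hjfix hjpow hEval hϖmax φ hφs hφi hφo hφγ hlam hΘh hh hform
    u hΓ hu hc hc' hc1 huc' huc2' hfinF hR' hJ hfinLS f (by simpa only [map_one] using hf')
  rw [map_pow, map_pow] at key
  rw [ncard_typeZero_fixed_levels_eq_block L w hw ϖ (endoGL (γ₂, u)) a b]   -- ★ p859323 (L0-P): the token set IS the block-form set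
  exact key

/-! ## §2 The anisotropic literal: `ι_w(t_a) = P₁·endoGL (γ₁, u)·P₁⁻¹` with `ᵗσ(P₁) Φ₃ P₁ = block(diag dg, η)` -/

/-- **(C2-lev) AT THE CM PLACE, ANISOTROPIC SHAPE — ★ p859229 in the token of ★ p858704 `pieceCountDictionary_levels (a b)`.**  For `P₁·endoGL (γ₁, u)·P₁⁻¹ ∈ U(σ_w, (Φ₃)_w)` with
the frame equation `formCongr σ_w P₁ (Φ₃)_w = block(Matrix.diagonal dg, η)` (`|dg i| = 1`, `σ_w dg = dg`, `|η| = 1`, `σ_w η = η` — socket (A′)'s letters), a line model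
`(M, jE, ρ, Θ, α; φ, lam, h)` of the plane `(Matrix.diagonal dg, γ₁)`, level schedules `a b : ℕ` with the near-`1` guards `|u₀₀ − 1| ≤ |ϖ|^a`, `|(u₀₀ − 1)²| ≤ |ϖ|^b`, under ★ p859229's
antecedents: `#{M₃ ∣ IsVertexLattice σ_w ϖ (antidiag₃) 0 M₃ ∧ (P₁ΓP₁⁻¹)·M₃ = M₃ ∧ LatticeInLevel ϖ a (P₁ΓP₁⁻¹ − 1) M₃ ∧ LatticeInLevel ϖ b ((P₁ΓP₁⁻¹ − 1)(P₁ΓP₁⁻¹ − 1)) M₃}` — the (D-G)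
census `cnt_{a,b}(P₁ΓP₁⁻¹)` — `=` ★ p859229's order form at `(H₂, h_W) := (Matrix.diagonal dg, η)`, `(c, c′) := (ϖ^a, ϖ^b)`, via ★ `ncard_selfDual_fixed_sep_eq_of_formCongr` (`M₃ ↦ P₁·M₃`)
with the two level labels carried by §0.  Instances of record `(a, b) := (ℓ₀, m_c), (ℓ₀ + 1, m_c)`.
[cite: Kottwitz1986BaseChangeUnits, §1 pp. 240–241] [cite: Rogawski1990, §4.9 Prop. 4.9.1 (a)(b) pp. 54–55, Lemma 4.9.3 p. 56] [cite: Jacobowitz1962, §4] [cite: BruhatTits1972, §10] -/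
theorem ncard_typeZero_fixed_conj_endoGL_levels_eq_orderForm (L : Type) [Field L] [NumberField L] [IsCMField L]
    {v : HeightOneSpectrum (𝓞 ↥(maximalRealSubfield L))} (w : UnitaryGroup.PlacesOver L v)
    (hw : IsCMField.complexConj L • w.1 = w.1) {ϖ : (w.1.adicCompletion L)} (hϖ : Valued.v ϖ = WithZero.exp (-1 : ℤ))
    {M : Type*} [Field M] [Valued M ℤᵐ⁰] {ρ Θ : M →+* M} {α : M} (jE : (w.1.adicCompletion L) →+* M)
    (hρρ : ∀ x, ρ (ρ x) = x) (hvρ : ∀ x, Valued.v (ρ x) = Valued.v x) (hα : ρ α ≠ α) (hα1 : Valued.v α ≤ 1)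
    (hint : ∀ z : M, Valued.v z ≤ 1 → Valued.v ((z - ρ z) / (α - ρ α)) ≤ 1)
    (hΘΘ : ∀ x, Θ (Θ x) = x) (hΘρ : ∀ x, Θ (ρ x) = ρ (Θ x)) (hvΘ : ∀ x, Valued.v (Θ x) = Valued.v x)
    (hΘj : ∀ x, Θ (jE x) = jE ((galAdicCompletionMap (L := L) (IsCMField.complexConj L) hw) x))
    (hjv : ∀ c, Valued.v (jE c) ≤ 1 ↔ Valued.v c ≤ 1) (hjfix : ∀ z, ρ z = z ↔ ∃ c, jE c = z)
    (hjpow : ∀ (t : (w.1.adicCompletion L)) (n : ℤ), Valued.v (jE t) = Valued.v (jE ϖ) ^ n ↔ Valued.v t = Valued.v ϖ ^ n)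
    (hEval : ∀ c : M, ρ c = c → c ≠ 0 → Valued.v c ≤ 1 → ∃ n : ℕ, Valued.v c = Valued.v (jE ϖ) ^ n)
    (hϖmax : ∀ t : M, ρ t = t → Valued.v t < 1 → Valued.v t ≤ Valued.v (jE ϖ))
    (P₁ : GL (Fin 3) (w.1.adicCompletion L)) (dg : Fin 2 → (w.1.adicCompletion L)) (η : (w.1.adicCompletion L))
    (γ₁ : GL (Fin 2) (w.1.adicCompletion L)) (u : GL (Fin 1) (w.1.adicCompletion L))
    (hfc : formCongr (galAdicCompletionMap (L := L) (IsCMField.complexConj L) hw) P₁ (placeForm (Matrix.of fun i j : Fin 3 => if i.val + j.val + 1 = 3 then (1 : L) else 0) w.1) =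
      (!![(Matrix.diagonal dg) 0 0, 0, (Matrix.diagonal dg) 0 1; 0, η, 0; (Matrix.diagonal dg) 1 0, 0, (Matrix.diagonal dg) 1 1] : Matrix (Fin 3) (Fin 3) (w.1.adicCompletion L)))
    (hdg1 : ∀ i, Valued.v (dg i) = 1) (hdgσ : ∀ i, (galAdicCompletionMap (L := L) (IsCMField.complexConj L) hw) (dg i) = dg i)
    (hησ : (galAdicCompletionMap (L := L) (IsCMField.complexConj L) hw) η = η) (hη1 : Valued.v η = 1)
    (hmem : P₁ * endoGL (γ₁, u) * P₁⁻¹ ∈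
      unitaryGroupOfForm (galAdicCompletionMap (L := L) (IsCMField.complexConj L) hw) (placeForm (Matrix.of fun i j : Fin 3 => if i.val + j.val + 1 = 3 then (1 : L) else 0) w.1))
    (hu : Valued.v ((u : Matrix (Fin 1) (Fin 1) (w.1.adicCompletion L)) 0 0) = 1) (a b : ℕ)
    (huc : Valued.v ((u : Matrix (Fin 1) (Fin 1) (w.1.adicCompletion L)) 0 0 - 1) ≤ Valued.v ϖ ^ a)
    (huc2 : Valued.v (((u : Matrix (Fin 1) (Fin 1) (w.1.adicCompletion L)) 0 0 - 1) ^ 2) ≤ Valued.v ϖ ^ b)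
    (φ : (Fin 2 → (w.1.adicCompletion L)) →+ M) (hφs : ∀ (c : (w.1.adicCompletion L)) (x : Fin 2 → (w.1.adicCompletion L)), φ (c • x) = jE c * φ x)
    (hφi : Function.Injective φ) (hφo : Function.Surjective φ)
    {lam h : M} (hφγ : ∀ x, φ ((γ₁ : Matrix (Fin 2) (Fin 2) (w.1.adicCompletion L)).mulVec x) = lam * φ x) (hlam : Valued.v lam = 1)
    (hΘh : Θ h = h) (hh : h ≠ 0)
    (hform : ∀ x y, jE (pairing (galAdicCompletionMap (L := L) (IsCMField.complexConj L) hw) (Matrix.diagonal dg) x y) = h * Θ (φ x) * φ y + ρ (h * Θ (φ x) * φ y))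
    {R : ℕ}
    (hfinF : {M₃ : Submodule (Valued.integer (w.1.adicCompletion L)) (Fin 3 → (w.1.adicCompletion L)) |
      IsSelfDualLattice (galAdicCompletionMap (L := L) (IsCMField.complexConj L) hw) ϖ
        (!![(Matrix.diagonal dg) 0 0, 0, (Matrix.diagonal dg) 0 1; 0, η, 0; (Matrix.diagonal dg) 1 0, 0, (Matrix.diagonal dg) 1 1] : Matrix (Fin 3) (Fin 3) (w.1.adicCompletion L)) M₃ ∧
      mapGL (endoGL (γ₁, u)) M₃ = M₃}.Finite)
    (hR : ∀ M₃ : Submodule (Valued.integer (w.1.adicCompletion L)) (Fin 3 → (w.1.adicCompletion L)),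
      IsSelfDualLattice (galAdicCompletionMap (L := L) (IsCMField.complexConj L) hw) ϖ
        (!![(Matrix.diagonal dg) 0 0, 0, (Matrix.diagonal dg) 0 1; 0, η, 0; (Matrix.diagonal dg) 1 0, 0, (Matrix.diagonal dg) 1 1] : Matrix (Fin 3) (Fin 3) (w.1.adicCompletion L)) M₃ →
      mapGL (endoGL (γ₁, u)) M₃ = M₃ → ∀ b' : ℕ, (∀ c : (w.1.adicCompletion L), (Pi.single 1 c : Fin 3 → (w.1.adicCompletion L)) ∈ M₃ ↔ Valued.v c ≤ Valued.v ϖ ^ b') → b' ≤ R)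
    {J : ℕ} (hJ : ¬ IsOrd ρ α (jE ϖ ^ (J + 1)) lam) (hfinLS : ∀ j a', (levelSet ρ Θ α (jE ϖ) h j a').Finite)
    (f : ℕ → ℕ → AddSubgroup M → ℕ)
    (hf : ∀ (b' j : ℕ) (Λ : AddSubgroup M) (x₀ : M) (r : (w.1.adicCompletion L)), 1 ≤ b' → x₀ ≠ 0 →
      (∀ x, x ∈ Λ ↔ ∃ z, IsOrd ρ α (jE ϖ ^ j) z ∧ x = x₀ * z) →
      IsOrd ρ α (jE ϖ ^ j) (dualGen ρ Θ α (jE ϖ ^ j) h x₀) → ¬ IsOrd ρ α (jE ϖ ^ j) (dualGen ρ Θ α (jE ϖ ^ j) h x₀ / jE ϖ) →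
      Valued.v (dualGen ρ Θ α (jE ϖ ^ j) h x₀) = Valued.v (jE ϖ) ^ b' →
      (∀ b'', (∀ x ∈ Λ, Valued.v (h * Θ x * b'' + ρ (h * Θ x * b'')) ≤ 1) → (lam - jE ((u : Matrix (Fin 1) (Fin 1) (w.1.adicCompletion L)) 0 0)) * b'' ∈ Λ) →
      IsOrd ρ α (jE ϖ ^ j) lam → jE r = glueUnit ρ Θ α (jE ϖ ^ j) h (jE ϖ) (jE η) x₀ b' →
      f b' j Λ = Nat.card {x : 𝒪[(w.1.adicCompletion L)] ⧸ 𝓂[(w.1.adicCompletion L)] ^ (2 * b') //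
        ∃ u' : 𝒪[(w.1.adicCompletion L)], Ideal.Quotient.mk (𝓂[(w.1.adicCompletion L)] ^ (2 * b')) u' = x ∧
          Valued.v ((u' : (w.1.adicCompletion L)) * (galAdicCompletionMap (L := L) (IsCMField.complexConj L) hw) u' - r) ≤ Valued.v (ϖ ^ (2 * b'))}) :
    {M₃ : Submodule (Valued.integer (w.1.adicCompletion L)) (Fin 3 → (w.1.adicCompletion L)) |
        IsVertexLattice (galAdicCompletionMap (L := L) (IsCMField.complexConj L) hw) ϖ ((StdForm.antidiagonal 3).over (w.1.adicCompletion L)) 0 M₃ ∧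
        mapGL (P₁ * endoGL (γ₁, u) * P₁⁻¹) M₃ = M₃ ∧
          (LatticeInLevel ϖ a (((P₁ * endoGL (γ₁, u) * P₁⁻¹ : GL (Fin 3) (w.1.adicCompletion L)) : Matrix (Fin 3) (Fin 3) (w.1.adicCompletion L)) - 1) M₃ ∧
            LatticeInLevel ϖ b ((((P₁ * endoGL (γ₁, u) * P₁⁻¹ : GL (Fin 3) (w.1.adicCompletion L)) : Matrix (Fin 3) (Fin 3) (w.1.adicCompletion L)) - 1) *
              (((P₁ * endoGL (γ₁, u) * P₁⁻¹ : GL (Fin 3) (w.1.adicCompletion L)) : Matrix (Fin 3) (Fin 3) (w.1.adicCompletion L)) - 1)) M₃)}.ncard =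
      (∑ j ∈ Finset.range (J + 1), (if IsOrd ρ α (jE ϖ ^ j) lam ∧ IsOrd ρ α (jE ϖ ^ j) ((jE ϖ ^ a)⁻¹ * (lam - 1)) ∧
          IsOrd ρ α (jE ϖ ^ j) ((jE ϖ ^ b)⁻¹ * ((lam - 1) * (lam - 1))) then (levelSet ρ Θ α (jE ϖ) h j 0).ncard else 0)) +
        ∑ b' ∈ Finset.Icc 1 R, ∑ j ∈ Finset.range (J + 1), (if IsOrd ρ α (jE ϖ ^ j) lam ∧ IsOrd ρ α (jE ϖ ^ j) ((jE ϖ ^ a)⁻¹ * (lam - 1)) ∧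
            IsOrd ρ α (jE ϖ ^ j) ((jE ϖ ^ b)⁻¹ * ((lam - 1) * (lam - 1))) then
          ∑ᶠ Λ ∈ levelSetDep ρ Θ α (jE ϖ) h j b' ((jE ϖ ^ a)⁻¹ * (lam - jE ((u : Matrix (Fin 1) (Fin 1) (w.1.adicCompletion L)) 0 0))) ∩
            levelSetDep ρ Θ α (jE ϖ) h j b' ((jE ϖ ^ b)⁻¹ * ((lam - 1) * (lam - 1) - jE (((u : Matrix (Fin 1) (Fin 1) (w.1.adicCompletion L)) 0 0 - 1) ^ 2))), f b' j Λ else 0) := by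
  haveI : IsPrincipalIdealRing 𝒪[w.1.adicCompletion L] := isPrincipalIdealRing_integer_adicCompletion L v w
  have hσ : ∀ a', (galAdicCompletionMap (L := L) (IsCMField.complexConj L) hw) ((galAdicCompletionMap (L := L) (IsCMField.complexConj L) hw) a') = a' :=
    galAdicCompletionMap_involutive L v w hw
  have hvσ : ∀ a', Valued.v ((galAdicCompletionMap (L := L) (IsCMField.complexConj L) hw) a') = Valued.v a' :=
    fun a' => valued_galAdicCompletionMap (L := L) (IsCMField.complexConj L) hw a'
  -- the uniformiser: `ϖ^a, ϖ^b ≠ 0`, `|ϖ^a| ≤ 1`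
  have hϖ0 : ϖ ≠ 0 := fun h0 => by rw [h0, map_zero] at hϖ; exact WithZero.coe_ne_zero hϖ.symm
  have hϖ1 : Valued.v ϖ ≤ 1 := by rw [hϖ, ← WithZero.exp_zero]; exact WithZero.exp_le_exp.2 (by norm_num)
  have hc : ϖ ^ a ≠ 0 := pow_ne_zero _ hϖ0
  have hc' : ϖ ^ b ≠ 0 := pow_ne_zero _ hϖ0
  have hc1 : Valued.v (ϖ ^ a) ≤ 1 := by rw [map_pow]; exact pow_le_one' hϖ1 a
  have huc' : Valued.v ((u : Matrix (Fin 1) (Fin 1) (w.1.adicCompletion L)) 0 0 - 1) ≤ Valued.v (ϖ ^ a) := by rw [map_pow Valued.v ϖ a]; exact huc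
  have huc2' : Valued.v (((u : Matrix (Fin 1) (Fin 1) (w.1.adicCompletion L)) 0 0 - 1) ^ 2) ≤ Valued.v (ϖ ^ b) := by rw [map_pow Valued.v ϖ b]; exact huc2
  -- `diag dg` is hermitian of unit determinant
  have hH₂ : IsUnit (Matrix.diagonal dg).det := by
    rw [Matrix.det_diagonal]
    refine isUnit_iff_ne_zero.2 (Finset.prod_ne_zero_iff.2 fun i _ h0 => ?_)
    have h1 := hdg1 i
    rw [h0, map_zero] at h1
    exact zero_ne_one h1
  have hH₂σ : ((Matrix.diagonal dg).map (galAdicCompletionMap (L := L) (IsCMField.complexConj L) hw))ᵀ = Matrix.diagonal dg := by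
    rw [Matrix.diagonal_map (map_zero _), Matrix.diagonal_transpose]
    exact congrArg Matrix.diagonal (funext hdgσ)
  -- the block element is unitary for the congruent form
  have hΓ : endoGL (γ₁, u) ∈ unitaryGroupOfForm (galAdicCompletionMap (L := L) (IsCMField.complexConj L) hw)
      (!![(Matrix.diagonal dg) 0 0, 0, (Matrix.diagonal dg) 0 1; 0, η, 0; (Matrix.diagonal dg) 1 0, 0, (Matrix.diagonal dg) 1 1] : Matrix (Fin 3) (Fin 3) (w.1.adicCompletion L)) := by
    rw [← hfc]
    exact (conj_mem_unitaryGroupOfForm_iff (galAdicCompletionMap (L := L) (IsCMField.complexConj L) hw) P₁ _ (endoGL (γ₁, u))).1 hmem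
  -- the socket's set is the `H`-side of the count transport along `M₃ ↦ P₁·M₃`, with the two level labels
  have e1 : {M₃ : Submodule (Valued.integer (w.1.adicCompletion L)) (Fin 3 → (w.1.adicCompletion L)) |
        IsVertexLattice (galAdicCompletionMap (L := L) (IsCMField.complexConj L) hw) ϖ ((StdForm.antidiagonal 3).over (w.1.adicCompletion L)) 0 M₃ ∧
        mapGL (P₁ * endoGL (γ₁, u) * P₁⁻¹) M₃ = M₃ ∧
          (LatticeInLevel ϖ a (((P₁ * endoGL (γ₁, u) * P₁⁻¹ : GL (Fin 3) (w.1.adicCompletion L)) : Matrix (Fin 3) (Fin 3) (w.1.adicCompletion L)) - 1) M₃ ∧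
            LatticeInLevel ϖ b ((((P₁ * endoGL (γ₁, u) * P₁⁻¹ : GL (Fin 3) (w.1.adicCompletion L)) : Matrix (Fin 3) (Fin 3) (w.1.adicCompletion L)) - 1) *
              (((P₁ * endoGL (γ₁, u) * P₁⁻¹ : GL (Fin 3) (w.1.adicCompletion L)) : Matrix (Fin 3) (Fin 3) (w.1.adicCompletion L)) - 1)) M₃)} =
      {M₃ : Submodule (Valued.integer (w.1.adicCompletion L)) (Fin 3 → (w.1.adicCompletion L)) |
        IsSelfDualLattice (galAdicCompletionMap (L := L) (IsCMField.complexConj L) hw) ϖ (placeForm (Matrix.of fun i j : Fin 3 => if i.val + j.val + 1 = 3 then (1 : L) else 0) w.1) M₃ ∧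
        mapGL (P₁ * endoGL (γ₁, u) * P₁⁻¹) M₃ = M₃ ∧
          (LatticeInLevel ϖ a (((P₁ * endoGL (γ₁, u) * P₁⁻¹ : GL (Fin 3) (w.1.adicCompletion L)) : Matrix (Fin 3) (Fin 3) (w.1.adicCompletion L)) - 1) M₃ ∧
            LatticeInLevel ϖ b ((((P₁ * endoGL (γ₁, u) * P₁⁻¹ : GL (Fin 3) (w.1.adicCompletion L)) : Matrix (Fin 3) (Fin 3) (w.1.adicCompletion L)) - 1) *
              (((P₁ * endoGL (γ₁, u) * P₁⁻¹ : GL (Fin 3) (w.1.adicCompletion L)) : Matrix (Fin 3) (Fin 3) (w.1.adicCompletion L)) - 1)) M₃)} := by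
    ext M₃
    simp only [Set.mem_setOf_eq, placeForm_antidiagOne]
  rw [e1, ncard_selfDual_fixed_sep_eq_of_formCongr (galAdicCompletionMap (L := L) (IsCMField.complexConj L) hw) ϖ _ P₁ (endoGL (γ₁, u)) _
    (fun M₃ => LatticeInLevel ϖ a (((endoGL (γ₁, u) : GL (Fin 3) (w.1.adicCompletion L)) : Matrix (Fin 3) (Fin 3) (w.1.adicCompletion L)) - 1) M₃ ∧
      LatticeInLevel ϖ b ((((endoGL (γ₁, u) : GL (Fin 3) (w.1.adicCompletion L)) : Matrix (Fin 3) (Fin 3) (w.1.adicCompletion L)) - 1) *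
        (((endoGL (γ₁, u) : GL (Fin 3) (w.1.adicCompletion L)) : Matrix (Fin 3) (Fin 3) (w.1.adicCompletion L)) - 1)) M₃)
    (fun M₃ => latticeInLevel_and_conj_mapGL_iff ϖ a b P₁ (endoGL (γ₁, u)) M₃), hfc]
  have key := ncard_fixed_selfDual_endoGL_lev_sq_eq_orderForm (galAdicCompletionMap (L := L) (IsCMField.complexConj L) hw) hσ hvσ hϖ hH₂ hH₂σ hη1 hησ jE hρρ hvρ hα hα1 hint
    hΘΘ hΘρ hvΘ hΘj hjv hjfix hjpow hEval hϖmax φ hφs hφi hφo hφγ hlam hΘh hh hform u hΓ hu hc hc' hc1 huc' huc2' hfinF hR hJ hfinLS f hf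
  rw [map_pow, map_pow] at key
  unfold LatticeInLevel
  exact key

/-! ## §3 The hermitian reading of the square clause (F0P3-p01 (g35) 10:05:48Z): `(T⁻¹ − 1)(T − 1) = X^*X` for unitary `T = 1 + X`, and the census is unchanged -/

section Hermitian

variable {K : Type*} [Field K] [Valued K ℤᵐ⁰]

omit [Valued K ℤᵐ⁰] in
/-- **THE ADJOINT OF `X = T − 1` IS `T⁻¹ − 1` FOR UNITARY `T`**: `T ∈ U(σ, H)`, `det H` a unit ⇒ `H⁻¹·ᵗσ(T − 1)·H = T⁻¹ − 1` (so `(T⁻¹ − 1)(T − 1) = X^*X = −(X + X^*)`, the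
hermitian operator of the square clause). [cite: Jacobowitz1962, §4] [cite: Rogawski1990, §4.9 Prop. 4.9.1 (b) p. 55] -/
theorem inv_mul_transpose_map_sub_one_mul_eq (σ : K →+* K) {H : Matrix (Fin 3) (Fin 3) K} (hH : IsUnit H.det) (T : GL (Fin 3) K)
    (hT : T ∈ unitaryGroupOfForm σ H) :
    H⁻¹ * (((T : Matrix (Fin 3) (Fin 3) K) - 1).map σ)ᵀ * H = ((T⁻¹ : GL (Fin 3) K) : Matrix (Fin 3) (Fin 3) K) - 1 := by
  have hU : ((T : Matrix (Fin 3) (Fin 3) K).map σ)ᵀ * H * (T : Matrix (Fin 3) (Fin 3) K) = H := mem_unitaryGroupOfForm_iff.1 hT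
  have hTT : (T : Matrix (Fin 3) (Fin 3) K) * ((T⁻¹ : GL (Fin 3) K) : Matrix (Fin 3) (Fin 3) K) = 1 := by
    rw [← Units.val_mul, mul_inv_cancel, Units.val_one]
  -- `ᵗσ(T)·H = H·T⁻¹`
  have hU' : ((T : Matrix (Fin 3) (Fin 3) K).map σ)ᵀ * H = H * ((T⁻¹ : GL (Fin 3) K) : Matrix (Fin 3) (Fin 3) K) := by
    calc ((T : Matrix (Fin 3) (Fin 3) K).map σ)ᵀ * H
        = ((T : Matrix (Fin 3) (Fin 3) K).map σ)ᵀ * H * (T : Matrix (Fin 3) (Fin 3) K) * ((T⁻¹ : GL (Fin 3) K) : Matrix (Fin 3) (Fin 3) K) := by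
          rw [Matrix.mul_assoc (((T : Matrix (Fin 3) (Fin 3) K).map σ)ᵀ * H), hTT, Matrix.mul_one]
      _ = H * ((T⁻¹ : GL (Fin 3) K) : Matrix (Fin 3) (Fin 3) K) := by rw [hU]
  have hmap : (((T : Matrix (Fin 3) (Fin 3) K) - 1).map σ)ᵀ = ((T : Matrix (Fin 3) (Fin 3) K).map σ)ᵀ - 1 := by
    rw [Matrix.map_sub _ (map_sub σ), Matrix.map_one σ (map_zero σ) (map_one σ), Matrix.transpose_sub, Matrix.transpose_one]
  rw [hmap, Matrix.mul_sub, Matrix.mul_one, Matrix.sub_mul, Matrix.mul_assoc, hU', ← Matrix.mul_assoc, Matrix.nonsing_inv_mul H hH, Matrix.one_mul]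

omit [Valued K ℤᵐ⁰] in
/-- `(T⁻¹ − 1)(T − 1) = −(T⁻¹·(T − 1)(T − 1))` in `M₃(K)`. [folklore] -/
theorem inv_sub_one_mul_sub_one_eq (T : GL (Fin 3) K) :
    (((T⁻¹ : GL (Fin 3) K) : Matrix (Fin 3) (Fin 3) K) - 1) * ((T : Matrix (Fin 3) (Fin 3) K) - 1) =
      -(((T⁻¹ : GL (Fin 3) K) : Matrix (Fin 3) (Fin 3) K) * (((T : Matrix (Fin 3) (Fin 3) K) - 1) * ((T : Matrix (Fin 3) (Fin 3) K) - 1))) := by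
  have hST : ((T⁻¹ : GL (Fin 3) K) : Matrix (Fin 3) (Fin 3) K) * (T : Matrix (Fin 3) (Fin 3) K) = 1 := by
    rw [← Units.val_mul, inv_mul_cancel, Units.val_one]
  simp only [Matrix.mul_sub, Matrix.sub_mul, Matrix.mul_one, Matrix.one_mul, ← Matrix.mul_assoc, hST]
  abel

/-- `LatticeInLevel ϖ ℓ (−X) M ↔ LatticeInLevel ϖ ℓ X M` (a submodule's image under `−f` is its image under `f`). [cite: Kottwitz1986BaseChangeUnits, §1 pp. 240–241] -/
theorem latticeInLevel_neg_iff (ϖ : K) (ℓ : ℕ) (X : Matrix (Fin 3) (Fin 3) K) (M : Submodule 𝒪[K] (Fin 3 → K)) :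
    LatticeInLevel ϖ ℓ (-X) M ↔ LatticeInLevel ϖ ℓ X M := by
  unfold LatticeInLevel
  rw [map_neg, LinearMap.restrictScalars_neg, Submodule.map_neg]

/-- `LatticeInLevel ϖ ℓ (T⁻¹·X) M ↔ LatticeInLevel ϖ ℓ X M` for a `T`-FIXED lattice `M` (`T⁻¹·M = M`, and `T⁻¹` carries `X·M ⊆ ϖ^ℓ M` to `T⁻¹X·M ⊆ ϖ^ℓ T⁻¹M`).
[cite: Kottwitz1986BaseChangeUnits, §1 pp. 240–241] -/
theorem latticeInLevel_inv_mul_iff_of_mapGL_eq (ϖ : K) (ℓ : ℕ) (T : GL (Fin 3) K) (X : Matrix (Fin 3) (Fin 3) K) (M : Submodule 𝒪[K] (Fin 3 → K))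
    (hT : mapGL T M = M) :
    LatticeInLevel ϖ ℓ (((T⁻¹ : GL (Fin 3) K) : Matrix (Fin 3) (Fin 3) K) * X) M ↔ LatticeInLevel ϖ ℓ X M := by
  have hT' : mapGL T⁻¹ M = M := by
    conv_lhs => rw [← hT]
    rw [← mapGL_mul, inv_mul_cancel, mapGL_one]
  unfold LatticeInLevel
  rw [map_toLin'_mul]
  change mapGL T⁻¹ (M.map ((Matrix.toLin' X).restrictScalars 𝒪[K])) ≤ scaleLattice (ϖ ^ ℓ) M ↔ _
  conv_lhs => rw [← hT', ← mapGL_scaleLattice, mapGL_le_mapGL_iff, hT']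

/-- **THE HERMITIAN SQUARE CLAUSE IS THE SQUARE CLAUSE ON A FIXED LATTICE**: for `T·M = M`, `LatticeInLevel ϖ ℓ ((T⁻¹ − 1)(T − 1)) M ↔ LatticeInLevel ϖ ℓ ((T − 1)(T − 1)) M`
(for unitary `T = 1 + X`: `X^*X·M ⊆ ϖ^ℓ M ↔ X²·M ⊆ ϖ^ℓ M` — the lattice side of F0P3-p01 (g35)'s `InLevel ϖ m_c (X^*X) ⟺ InLevel ϖ m_c (X·X)` on `K`).
[cite: Kottwitz1986BaseChangeUnits, §1 pp. 240–241] [cite: Rogawski1990, §4.9 Prop. 4.9.1 (b) p. 55] -/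
theorem latticeInLevel_herm_iff_of_mapGL_eq (ϖ : K) (ℓ : ℕ) (T : GL (Fin 3) K) (M : Submodule 𝒪[K] (Fin 3 → K)) (hT : mapGL T M = M) :
    LatticeInLevel ϖ ℓ ((((T⁻¹ : GL (Fin 3) K) : Matrix (Fin 3) (Fin 3) K) - 1) * ((T : Matrix (Fin 3) (Fin 3) K) - 1)) M ↔
      LatticeInLevel ϖ ℓ (((T : Matrix (Fin 3) (Fin 3) K) - 1) * ((T : Matrix (Fin 3) (Fin 3) K) - 1)) M := by
  rw [inv_sub_one_mul_sub_one_eq, latticeInLevel_neg_iff, latticeInLevel_inv_mul_iff_of_mapGL_eq ϖ ℓ T _ M hT]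

/-- **THE CENSUS WITH THE HERMITIAN SQUARE CLAUSE IS `cnt_{a,b}`** (any `σ`, `ϖ`, any literal `T ∈ GL₃`): `#{M ∣ type-0, T·M = M, (T − 1)M ⊆ ϖ^a M, (T⁻¹ − 1)(T − 1)M ⊆ ϖ^b M}
= #{M ∣ type-0, T·M = M, (T − 1)M ⊆ ϖ^a M, (T − 1)²M ⊆ ϖ^b M}` — ★ p858704's token with the square clause read hermitian-wise; so §1∕§2 price this census too.
[cite: Kottwitz1986BaseChangeUnits, §1 pp. 240–241] [cite: Rogawski1990, §4.9 Prop. 4.9.1 (b) p. 55] -/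
theorem ncard_typeZero_fixed_levels_herm_eq (σ : K →+* K) (ϖ : K) (a b : ℕ) (T : GL (Fin 3) K) :
    {M : Submodule 𝒪[K] (Fin 3 → K) | IsVertexLattice σ ϖ ((StdForm.antidiagonal 3).over K) 0 M ∧ mapGL T M = M ∧
        (LatticeInLevel ϖ a ((T : Matrix (Fin 3) (Fin 3) K) - 1) M ∧
          LatticeInLevel ϖ b ((((T⁻¹ : GL (Fin 3) K) : Matrix (Fin 3) (Fin 3) K) - 1) * ((T : Matrix (Fin 3) (Fin 3) K) - 1)) M)}.ncard =
      {M : Submodule 𝒪[K] (Fin 3 → K) | IsVertexLattice σ ϖ ((StdForm.antidiagonal 3).over K) 0 M ∧ mapGL T M = M ∧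
        (LatticeInLevel ϖ a ((T : Matrix (Fin 3) (Fin 3) K) - 1) M ∧
          LatticeInLevel ϖ b (((T : Matrix (Fin 3) (Fin 3) K) - 1) * ((T : Matrix (Fin 3) (Fin 3) K) - 1)) M)}.ncard := by
  congr 1
  ext M
  simp only [Set.mem_setOf_eq]
  exact ⟨fun ⟨h0, hT, ha, hb⟩ => ⟨h0, hT, ha, (latticeInLevel_herm_iff_of_mapGL_eq ϖ b T M hT).1 hb⟩,
    fun ⟨h0, hT, ha, hb⟩ => ⟨h0, hT, ha, (latticeInLevel_herm_iff_of_mapGL_eq ϖ b T M hT).2 hb⟩⟩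

end Hermitian
end Summit.HodgeConjecture.HodgeConjecture.Cruxes.H413.F0P3cDyRamLevelsCensusOrderFormCM

end
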